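import Literature.NumberTheory.Sieve.SmoothCubeWeights
import HarnessLib

/-!
# Cube weights from a general logarithmic profile; the `log`-twisted weight

Topic `Literature/NumberTheory/Sieve`, namespace `SmoothWeights` (continuation of
`SmoothCubeWeights.lean`). The type I sums `S₃` of Vaughan's identity carry the factor
`log N((α)/𝔟) = d log M + ∑_w log(σ_w α/M) − log N𝔟` (Hinz 1988, §4, p. 185), so besides the cube
weight `g_t(r) = κ_t(log r)` one needs the weight `(log r) g_t(r) = (vκ_t)(log r)`, `v = log r`.
Both are instances of `gOf k (r) = k(log r)` for a smooth profile `k` supported in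
`[a − log 2, 0]`; this file proves the properties of `gOf k` once for all such `k`
(generalising the `gfun` section of `SmoothCubeWeights.lean`, whose proofs are repeated verbatim
with `κ_t` replaced by `k`) and instantiates them. Everything is PROVED:

* `gOf k`, `gOf_of_pos`, `gOf_eq_zero_of_le`, `gOf_eq_zero_of_one_le`, `support_gOf_subset`,
  `contDiff_gOf`, `abs_gOf_le` — the weight `k(log r)` (`0` for `r ≤ 0`);
* `iteratedDeriv_three_gOf` — `g⁽³⁾(r) = (k⁽³⁾ − 3k⁽²⁾ + 2k⁽¹⁾)(log r)/r³`;
  `norm_iteratedDeriv_three_gOf_le` — `|g⁽³⁾| ≤ 48 D e^{-3a}` if `|k^{(n)}| ≤ D` (`n ≤ 3`);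
* `gOfC`, `gOfC_props` — the complex-valued weight: `C³`, compact support in `[e^a/2, 1]`,
  `|g| ≤ D`, `∫|g| ≤ D`, `∫|g⁽³⁾| ≤ 48 D e^{-3a}` (`a ≤ 0`);
* `kappaTD`, `norm_iteratedDeriv_kappaT_le_kappaTD` — one constant
  `D_t = (1 + K₃) ε^{-3} (1+t)³ e^{t(log 2 − a)}` for `|κ_t^{(n)}|`, `n ≤ 3`;
* `kappaTL a ε t v = v κ_t(v)`, `norm_iteratedDeriv_kappaTL_le` —
  `|(vκ_t)^{(n)}| ≤ (log 2 − a + 3) D_t` (`n ≤ 3`, Leibniz);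
* `gfun_eq_gOf`, `gfunL`, `gfunL_of_pos` — `g_t = gOf κ_t` and the `log`-twisted weight
  `gfunL = gOf (vκ_t)`, `gfunL(r) = (log r) g_t(r)`.

## References

* J. Hinz, Acta Arith. 51 (1988), §4 (the sum `S₃`, p. 185). [cite: Hinz1988, §4]
-/

noncomputable section

open Real Set Filter MeasureTheory
open scoped Topology ContDiff

namespace Literature.NumberTheory.Sieve.SmoothWeights

/-! ## The weight `gOf k (r) = k(log r)` for a general profile `k` -/

section General

variable {k : ℝ → ℝ} {a : ℝ}

/-- The weight `r ↦ k(log r)` (`0` for `r ≤ 0`) attached to a logarithmic profile `k`. [folklore] -/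
def gOf (k : ℝ → ℝ) (r : ℝ) : ℝ := if 0 < r then k (Real.log r) else 0

/-- `gOf k (r) = k(log r)` for `r > 0`. [folklore] -/
theorem gOf_of_pos (k : ℝ → ℝ) {r : ℝ} (hr : 0 < r) : gOf k r = k (Real.log r) := by
  rw [gOf, if_pos hr]

/-- `gOf k = 0` on `(-∞, e^a/2]` if `k = 0` on `(-∞, a − log 2]`. [folklore] -/
theorem gOf_eq_zero_of_le (hlo : ∀ v, v ≤ a - Real.log 2 → k v = 0) {r : ℝ} (hr : r ≤ Real.exp a / 2) :
    gOf k r = 0 := by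
  by_cases h0 : 0 < r
  · rw [gOf_of_pos k h0]
    apply hlo
    rw [le_sub_iff_add_le, ← Real.log_mul h0.ne' two_ne_zero]
    calc Real.log (r * 2) ≤ Real.log (Real.exp a) := Real.log_le_log (by positivity) (by linarith)
      _ = a := Real.log_exp a
  · rw [gOf, if_neg h0]

/-- `gOf k = 0` on `[1, ∞)` if `k = 0` on `[0, ∞)`. [folklore] -/
theorem gOf_eq_zero_of_one_le (hhi : ∀ v, 0 ≤ v → k v = 0) {r : ℝ} (hr : 1 ≤ r) : gOf k r = 0 := by
  rw [gOf_of_pos k (by linarith)]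
  exact hhi _ (Real.log_nonneg hr)

/-- `supp (gOf k) ⊆ [e^a/2, 1]`. [folklore] -/
theorem support_gOf_subset (hlo : ∀ v, v ≤ a - Real.log 2 → k v = 0) (hhi : ∀ v, 0 ≤ v → k v = 0) :
    Function.support (gOf k) ⊆ Icc (Real.exp a / 2) 1 := by
  intro r hr
  rw [Function.mem_support] at hr
  rw [mem_Icc]
  constructor
  · by_contra h; push Not at h; exact hr (gOf_eq_zero_of_le hlo h.le)
  · by_contra h; push Not at h; exact hr (gOf_eq_zero_of_one_le hhi h.le)

/-- `gOf k` has compact support. [folklore] -/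
theorem hasCompactSupport_gOf (hlo : ∀ v, v ≤ a - Real.log 2 → k v = 0) (hhi : ∀ v, 0 ≤ v → k v = 0) :
    HasCompactSupport (gOf k) :=
  HasCompactSupport.of_support_subset_isCompact isCompact_Icc (support_gOf_subset hlo hhi)

/-- Near a positive point `gOf k` is `k ∘ log`. [folklore] -/
theorem gOf_eventuallyEq_comp (k : ℝ → ℝ) {r : ℝ} (hr : 0 < r) :
    gOf k =ᶠ[𝓝 r] fun s => k (Real.log s) :=
  (eventually_gt_nhds hr).mono fun _ hs => gOf_of_pos k hs

/-- Near a point `< e^a/2` the weight vanishes identically. [folklore] -/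
theorem gOf_eventuallyEq_zero (hlo : ∀ v, v ≤ a - Real.log 2 → k v = 0) {r : ℝ} (hr : r < Real.exp a / 2) :
    gOf k =ᶠ[𝓝 r] fun _ => 0 :=
  (eventually_lt_nhds hr).mono fun _ hs => gOf_eq_zero_of_le hlo hs.le

/-- `gOf k` is smooth if `k` is. [folklore] -/
theorem contDiff_gOf (hk : ContDiff ℝ (⊤ : ℕ∞) k) (hlo : ∀ v, v ≤ a - Real.log 2 → k v = 0) {n : ℕ∞} :
    ContDiff ℝ n (gOf k) := by
  rw [contDiff_iff_contDiffAt]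
  intro r
  by_cases hr : 0 < r
  · exact ((hk.of_le (by exact_mod_cast le_top)).contDiffAt.comp r
      (Real.contDiffAt_log.2 hr.ne')).congr_of_eventuallyEq (gOf_eventuallyEq_comp k hr)
  · have hr' : r < Real.exp a / 2 := lt_of_le_of_lt (not_lt.1 hr) (by positivity)
    exact (contDiffAt_const (c := (0 : ℝ))).congr_of_eventuallyEq (gOf_eventuallyEq_zero hlo hr')

/-- `|gOf k| ≤ D` if `|k| ≤ D`. [folklore] -/
theorem abs_gOf_le {D : ℝ} (hD : 0 ≤ D) (h0 : ∀ v, ‖k v‖ ≤ D) (r : ℝ) : |gOf k r| ≤ D := by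
  by_cases hr : 0 < r
  · rw [gOf_of_pos k hr, ← Real.norm_eq_abs]; exact h0 _
  · rw [gOf, if_neg hr, abs_zero]; exact hD

/-- **The third derivative of `gOf k`**: for `r > 0` and smooth `k`,
`(gOf k)⁽³⁾(r) = (k⁽³⁾(log r) − 3 k⁽²⁾(log r) + 2 k⁽¹⁾(log r)) / r³`. [folklore] -/
theorem iteratedDeriv_three_gOf (hk : ContDiff ℝ (⊤ : ℕ∞) k) {r : ℝ} (hr : 0 < r) :
    iteratedDeriv 3 (gOf k) r =
      (iteratedDeriv 3 k (Real.log r) - 3 * iteratedDeriv 2 k (Real.log r) +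
        2 * iteratedDeriv 1 k (Real.log r)) * (r ^ 3)⁻¹ := by
  have hkd : ∀ n : ℕ, Differentiable ℝ (iteratedDeriv n k) := fun n =>
    (hk.differentiable_iteratedDeriv n (by exact_mod_cast WithTop.coe_lt_top _))
  set G₁ : ℝ → ℝ := fun s => iteratedDeriv 1 k (Real.log s) * s⁻¹ with hG₁
  set G₂ : ℝ → ℝ := fun s => (iteratedDeriv 2 k (Real.log s) - iteratedDeriv 1 k (Real.log s)) * (s ^ 2)⁻¹
    with hG₂
  set G₃ : ℝ → ℝ := fun s => (iteratedDeriv 3 k (Real.log s) - 3 * iteratedDeriv 2 k (Real.log s) +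
    2 * iteratedDeriv 1 k (Real.log s)) * (s ^ 3)⁻¹ with hG₃
  have h1 : EqOn (deriv (gOf k)) G₁ (Ioi 0) := by
    intro s hs
    rw [(gOf_eventuallyEq_comp k hs).deriv_eq]
    have h := hasDerivAt_comp_log (hkd 0) hs
    simp only [iteratedDeriv_zero] at h
    rw [hG₁, h.deriv, ← iteratedDeriv_one]
  have h2 : EqOn (deriv G₁) G₂ (Ioi 0) := by
    intro s hs
    have hs0 : s ≠ 0 := ne_of_gt hs
    have hA := hasDerivAt_comp_log (hkd 1) hs
    rw [← iteratedDeriv_succ] at hA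
    have hB : HasDerivAt (fun x : ℝ => x⁻¹) (-(s ^ 2)⁻¹) s := hasDerivAt_inv hs0
    have h : HasDerivAt (fun x => iteratedDeriv 1 k (Real.log x) * x⁻¹)
        (iteratedDeriv (1 + 1) k (Real.log s) * s⁻¹ * s⁻¹ + iteratedDeriv 1 k (Real.log s) * -(s ^ 2)⁻¹) s :=
      hA.mul hB
    rw [hG₂, hG₁, h.deriv]
    field_simp
    ring
  have h3 : EqOn (deriv G₂) G₃ (Ioi 0) := by
    intro s hs
    have hs0 : s ≠ 0 := ne_of_gt hs
    have hA2 := hasDerivAt_comp_log (hkd 2) hs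
    have hA1 := hasDerivAt_comp_log (hkd 1) hs
    rw [← iteratedDeriv_succ] at hA2 hA1
    have hB : HasDerivAt (fun x : ℝ => (x ^ 2)⁻¹) (-(↑(2 : ℕ) * s ^ (2 - 1)) / (s ^ 2) ^ 2) s :=
      (hasDerivAt_pow 2 s).inv (pow_ne_zero _ hs0)
    have h : HasDerivAt (fun x => (iteratedDeriv 2 k (Real.log x) - iteratedDeriv 1 k (Real.log x)) * (x ^ 2)⁻¹)
        ((iteratedDeriv (2 + 1) k (Real.log s) * s⁻¹ - iteratedDeriv (1 + 1) k (Real.log s) * s⁻¹) * (s ^ 2)⁻¹ +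
          (iteratedDeriv 2 k (Real.log s) - iteratedDeriv 1 k (Real.log s)) *
            (-(↑(2 : ℕ) * s ^ (2 - 1)) / (s ^ 2) ^ 2)) s :=
      (hA2.sub hA1).mul hB
    rw [hG₃, hG₂, h.deriv]
    push_cast
    field_simp
    ring
  have e1 : EqOn (deriv (deriv (gOf k))) G₂ (Ioi 0) := fun s hs => by
    rw [eqOn_deriv_Ioi h1 hs]; exact h2 hs
  have e2 : EqOn (deriv (deriv (deriv (gOf k)))) G₃ (Ioi 0) := fun s hs => by
    rw [eqOn_deriv_Ioi e1 hs]; exact h3 hs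
  rw [show (3 : ℕ) = 2 + 1 from rfl, iteratedDeriv_succ, iteratedDeriv_succ, iteratedDeriv_one]
  exact e2 hr

/-- All derivatives of `gOf k` vanish below `e^a/2`. [folklore] -/
theorem iteratedDeriv_gOf_eq_zero (hlo : ∀ v, v ≤ a - Real.log 2 → k v = 0) {r : ℝ}
    (hr : r < Real.exp a / 2) (n : ℕ) : iteratedDeriv n (gOf k) r = 0 := by
  have h := (gOf_eventuallyEq_zero hlo hr).iteratedDeriv n
  rw [h.eq_of_nhds, iteratedDeriv_const]
  split_ifs <;> rfl

/-- **Bound for the third derivative of `gOf k`**: if `|k^{(n)}| ≤ D` for `n = 1, 2, 3` then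
`|(gOf k)⁽³⁾(r)| ≤ 48 D e^{-3a}` for all `r`. [folklore] -/
theorem norm_iteratedDeriv_three_gOf_le (hk : ContDiff ℝ (⊤ : ℕ∞) k) (hlo : ∀ v, v ≤ a - Real.log 2 → k v = 0)
    {D : ℝ} (hD : 0 ≤ D) (hB : ∀ n, 1 ≤ n → n ≤ 3 → ∀ v, ‖iteratedDeriv n k v‖ ≤ D) (r : ℝ) :
    ‖iteratedDeriv 3 (gOf k) r‖ ≤ 48 * D * Real.exp (-3 * a) := by
  by_cases hr : r < Real.exp a / 2
  · rw [iteratedDeriv_gOf_eq_zero hlo hr, norm_zero]; positivity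
  push Not at hr
  have hea : 0 < Real.exp a / 2 := by positivity
  have hr0 : 0 < r := lt_of_lt_of_le hea hr
  rw [iteratedDeriv_three_gOf hk hr0, norm_mul]
  have hn3 : ‖(r ^ 3)⁻¹‖ = (r ^ 3)⁻¹ := by
    rw [Real.norm_eq_abs, abs_of_pos (by positivity)]
  rw [hn3]
  have hsum : ‖iteratedDeriv 3 k (Real.log r) - 3 * iteratedDeriv 2 k (Real.log r) +
      2 * iteratedDeriv 1 k (Real.log r)‖ ≤ 6 * D := by
    have h3 := hB 3 (by norm_num) le_rfl (Real.log r)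
    have h2 := hB 2 (by norm_num) (by norm_num) (Real.log r)
    have h1 := hB 1 le_rfl (by norm_num) (Real.log r)
    have hn2 : ‖3 * iteratedDeriv 2 k (Real.log r)‖ ≤ 3 * D := by rw [norm_mul, Real.norm_ofNat]; linarith
    have hn1 : ‖2 * iteratedDeriv 1 k (Real.log r)‖ ≤ 2 * D := by rw [norm_mul, Real.norm_ofNat]; linarith
    calc _ ≤ ‖iteratedDeriv 3 k (Real.log r) - 3 * iteratedDeriv 2 k (Real.log r)‖ +
          ‖2 * iteratedDeriv 1 k (Real.log r)‖ := norm_add_le _ _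
      _ ≤ ‖iteratedDeriv 3 k (Real.log r)‖ + ‖3 * iteratedDeriv 2 k (Real.log r)‖ +
          ‖2 * iteratedDeriv 1 k (Real.log r)‖ := by gcongr; exact norm_sub_le _ _
      _ ≤ _ := by linarith
  have hr3 : (r ^ 3)⁻¹ ≤ 8 * Real.exp (-3 * a) := by
    have h1 : (r ^ 3)⁻¹ ≤ ((Real.exp a / 2) ^ 3)⁻¹ :=
      inv_anti₀ (pow_pos hea 3) (pow_le_pow_left₀ hea.le hr 3)
    refine h1.trans (le_of_eq ?_)
    have : Real.exp (-3 * a) = (Real.exp a)⁻¹ ^ 3 := by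
      rw [← Real.exp_neg, ← Real.exp_nat_mul]; push_cast; ring_nf
    rw [this]
    field_simp
    ring
  calc ‖iteratedDeriv 3 k (Real.log r) - 3 * iteratedDeriv 2 k (Real.log r) +
        2 * iteratedDeriv 1 k (Real.log r)‖ * (r ^ 3)⁻¹ ≤ 6 * D * (8 * Real.exp (-3 * a)) :=
        mul_le_mul hsum hr3 (by positivity) (by positivity)
    _ = _ := by ring

/-! ### The complex-valued weight and its `L¹` bounds -/

/-- The weight as a complex-valued function. [folklore] -/
def gOfC (k : ℝ → ℝ) (r : ℝ) : ℂ := (gOf k r : ℂ)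

/-- `gOfC = ofReal ∘ gOf`. [folklore] -/
theorem gOfC_eq_comp (k : ℝ → ℝ) : gOfC k = Complex.ofRealCLM ∘ gOf k := rfl

/-- `gOfC k` is smooth. [folklore] -/
theorem contDiff_gOfC (hk : ContDiff ℝ (⊤ : ℕ∞) k) (hlo : ∀ v, v ≤ a - Real.log 2 → k v = 0) {n : ℕ∞} :
    ContDiff ℝ n (gOfC k) := by
  rw [gOfC_eq_comp]; exact Complex.ofRealCLM.contDiff.comp (contDiff_gOf hk hlo)

/-- `supp (gOfC k) ⊆ [e^a/2, 1]`. [folklore] -/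
theorem support_gOfC_subset (hlo : ∀ v, v ≤ a - Real.log 2 → k v = 0) (hhi : ∀ v, 0 ≤ v → k v = 0) :
    Function.support (gOfC k) ⊆ Icc (Real.exp a / 2) 1 := by
  intro r hr
  rw [Function.mem_support, gOfC, Ne, Complex.ofReal_eq_zero] at hr
  exact support_gOf_subset hlo hhi (Function.mem_support.2 hr)

/-- `gOfC k` has compact support. [folklore] -/
theorem hasCompactSupport_gOfC (hlo : ∀ v, v ≤ a - Real.log 2 → k v = 0) (hhi : ∀ v, 0 ≤ v → k v = 0) :
    HasCompactSupport (gOfC k) :=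
  HasCompactSupport.of_support_subset_isCompact isCompact_Icc (support_gOfC_subset hlo hhi)

/-- Iterated derivatives commute with `ℝ → ℂ`. [folklore] -/
theorem iteratedDeriv_gOfC (hk : ContDiff ℝ (⊤ : ℕ∞) k) (hlo : ∀ v, v ≤ a - Real.log 2 → k v = 0)
    (n : ℕ) (r : ℝ) :
    iteratedDeriv n (gOfC k) r = ((iteratedDeriv n (gOf k) r : ℝ) : ℂ) := by
  rw [iteratedDeriv_eq_iteratedFDeriv, gOfC_eq_comp,
    ContinuousLinearMap.iteratedFDeriv_comp_left Complex.ofRealCLM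
      ((contDiff_gOf hk hlo (n := ⊤)).contDiffAt (x := r)) (i := n) (by exact_mod_cast le_top),
    ContinuousLinearMap.compContinuousMultilinearMap_coe, Function.comp_apply,
    ← iteratedDeriv_eq_iteratedFDeriv]
  rfl

/-- **Summary of the properties of `gOfC k`** for a smooth profile `k` vanishing off
`(a − log 2, 0)` with `|k^{(n)}| ≤ D` for `n ≤ 3` (`a ≤ 0`): smoothness, compact support in
`[e^a/2, 1]`, `|g| ≤ D`, `∫|g| ≤ D`, `∫|g⁽³⁾| ≤ 48 D e^{-3a}`. [folklore] -/
theorem gOfC_props (hk : ContDiff ℝ (⊤ : ℕ∞) k) (hlo : ∀ v, v ≤ a - Real.log 2 → k v = 0)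
    (hhi : ∀ v, 0 ≤ v → k v = 0) (ha : a ≤ 0) {D : ℝ} (hD : 0 ≤ D)
    (hB : ∀ n, n ≤ 3 → ∀ v, ‖iteratedDeriv n k v‖ ≤ D) :
    ContDiff ℝ 3 (gOfC k) ∧ HasCompactSupport (gOfC k) ∧
      Function.support (gOfC k) ⊆ Icc (Real.exp a / 2) 1 ∧
      (∀ r, ‖gOfC k r‖ ≤ D) ∧ (∫ r, ‖gOfC k r‖ ≤ D) ∧
      (∫ r, ‖iteratedDeriv 3 (gOfC k) r‖ ≤ 48 * D * Real.exp (-3 * a)) := by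
  have hlohi : Real.exp a / 2 ≤ 1 := by
    have : Real.exp a ≤ 1 := Real.exp_le_one_iff.2 ha
    linarith
  have h0 : ∀ v, ‖k v‖ ≤ D := fun v => by simpa using hB 0 (by norm_num) v
  have hpt : ∀ r, ‖gOfC k r‖ ≤ D := fun r => by
    rw [gOfC, Complex.norm_real, Real.norm_eq_abs]; exact abs_gOf_le hD h0 r
  have hsupp3 : Function.support (iteratedDeriv 3 (gOfC k)) ⊆ Icc (Real.exp a / 2) 1 := by
    intro r hr
    have h1 : r ∈ Function.support (iteratedFDeriv ℝ 3 (gOfC k)) := by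
      rw [Function.mem_support] at hr ⊢
      intro h0'
      apply hr
      rw [iteratedDeriv_eq_iteratedFDeriv, h0', zero_apply]
    exact closure_minimal (support_gOfC_subset hlo hhi) isClosed_Icc (support_iteratedFDeriv_subset 3 h1)
  refine ⟨contDiff_gOfC hk hlo, hasCompactSupport_gOfC hlo hhi, support_gOfC_subset hlo hhi, hpt, ?_, ?_⟩
  · calc ∫ r, ‖gOfC k r‖ ≤ D * (1 - Real.exp a / 2) :=
          integral_norm_le_of_support hlohi hpt (support_gOfC_subset hlo hhi)
      _ ≤ D * 1 := by gcongr; linarith [Real.exp_pos a]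
      _ = D := mul_one _
  · calc ∫ r, ‖iteratedDeriv 3 (gOfC k) r‖ ≤ 48 * D * Real.exp (-3 * a) * (1 - Real.exp a / 2) :=
          integral_norm_le_of_support hlohi (fun r => by
            rw [iteratedDeriv_gOfC hk hlo, Complex.norm_real]
            exact norm_iteratedDeriv_three_gOf_le hk hlo hD (fun n h1 h3 v => hB n h3 v) r)
            hsupp3
      _ ≤ 48 * D * Real.exp (-3 * a) * 1 := by gcongr; linarith [Real.exp_pos a]
      _ = _ := mul_one _

end General

/-! ## One constant for the derivatives of `κ_t` of orders `≤ 3` -/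

section KappaT

/-- `D_t = (1 + K₃) ε^{-3} (1+t)³ e^{t(log 2 − a)}`. [folklore] -/
def kappaTD (a ε t : ℝ) : ℝ := (1 + K3) * (ε ^ 3)⁻¹ * (1 + t) ^ 3 * Real.exp (t * (Real.log 2 - a))

/-- `D_t ≥ 0`. [folklore] -/
theorem kappaTD_nonneg (a : ℝ) {ε : ℝ} (hε : 0 < ε) {t : ℝ} (ht : 0 ≤ t) : 0 ≤ kappaTD a ε t := by
  unfold kappaTD; have := K3_nonneg; positivity

/-- `|κ_t^{(n)}(v)| ≤ D_t` for `n ≤ 3` (`0 < ε ≤ 1`, `t ≥ 0`). [folklore] -/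
theorem norm_iteratedDeriv_kappaT_le_kappaTD {n : ℕ} (hn : n ≤ 3) (a : ℝ) {ε : ℝ} (hε : 0 < ε) (hε1 : ε ≤ 1)
    {t : ℝ} (ht : 0 ≤ t) (v : ℝ) : ‖iteratedDeriv n (kappaT a ε t) v‖ ≤ kappaTD a ε t := by
  set E := Real.exp (t * (Real.log 2 - a)) with hE
  have hK := K3_nonneg
  have ht1 : 1 ≤ 1 + t := by linarith
  have hε3 : 1 ≤ (ε ^ 3)⁻¹ := one_le_inv_iff₀.2 ⟨pow_pos hε 3, pow_le_one₀ hε.le hε1⟩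
  have hbase : E ≤ kappaTD a ε t := by
    unfold kappaTD
    calc E = 1 * 1 * 1 * E := by ring
      _ ≤ (1 + K3) * (ε ^ 3)⁻¹ * (1 + t) ^ 3 * E := by
          gcongr
          · linarith
          · exact one_le_pow₀ ht1
  rcases Nat.eq_zero_or_pos n with rfl | hn1
  · rw [iteratedDeriv_zero, Real.norm_eq_abs]
    exact (abs_kappaT_le ht v).trans hbase
  · refine (norm_iteratedDeriv_kappaT_le n a hε hε1 ht v).trans ?_
    unfold kappaTD
    have hεn : (ε ^ n)⁻¹ ≤ (ε ^ 3)⁻¹ := inv_anti₀ (pow_pos hε _) (pow_le_pow_of_le_one hε.le hε1 hn)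
    have htn : (1 + t) ^ n ≤ (1 + t) ^ 3 := pow_le_pow_right₀ ht1 hn
    have hKn : kappaTC n ≤ 1 + K3 := (kappaTC_le_K3 hn1 hn).trans (by linarith)
    have := kappaTC_nonneg n
    gcongr

end KappaT

/-! ## The `log`-twisted profile `v κ_t(v)` -/

section Log

/-- `(vκ_t)(v) = v κ_t(v)`: in the variable `r = e^v` this is `(log r) κ_t(log r)`. [folklore] -/
def kappaTL (a ε t v : ℝ) : ℝ := v * kappaT a ε t v

/-- `vκ_t` is smooth. [folklore] -/
theorem contDiff_kappaTL (a ε t : ℝ) {n : ℕ∞} : ContDiff ℝ n (kappaTL a ε t) :=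
  contDiff_id.mul (contDiff_kappaT a ε t)

/-- `vκ_t = 0` on `(-∞, a − log 2]`. [folklore] -/
theorem kappaTL_eq_zero_of_le {a ε t v : ℝ} (hv : v ≤ a - Real.log 2) : kappaTL a ε t v = 0 := by
  rw [kappaTL, kappaT_eq_zero_of_le hv, mul_zero]

/-- `vκ_t = 0` on `[0, ∞)`. [folklore] -/
theorem kappaTL_eq_zero_of_ge {a ε t v : ℝ} (hε : 0 < ε) (hv : 0 ≤ v) : kappaTL a ε t v = 0 := by
  rw [kappaTL, kappaT_eq_zero_of_ge hε hv, mul_zero]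

/-- `tsupp (vκ_t) ⊆ [a − log 2, 0]`. [folklore] -/
theorem tsupport_kappaTL_subset {a ε : ℝ} (hε : 0 < ε) (t : ℝ) :
    tsupport (kappaTL a ε t) ⊆ Icc (a - Real.log 2) 0 :=
  (tsupport_mul_subset_right (f := fun v : ℝ => v) (g := kappaT a ε t)).trans (tsupport_kappaT_subset hε t)

/-- Derivatives of the identity: `|id^{(i)}(v)|` is `|v|`, `1`, `0, 0, …`. [folklore] -/
theorem norm_iteratedFDeriv_id_le (i : ℕ) (v : ℝ) :
    ‖iteratedFDeriv ℝ i (fun x : ℝ => x) v‖ ≤ if i = 0 then |v| else if i = 1 then 1 else 0 := by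
  rw [norm_iteratedFDeriv_eq_norm_iteratedDeriv, iteratedDeriv_fun_id]
  split_ifs <;> simp

/-- **Derivative bounds for `vκ_t`**: `|(vκ_t)^{(n)}(v)| ≤ (log 2 − a + 3) D_t` for `n ≤ 3`
(`a ≤ 0`, `0 < ε ≤ 1`, `t ≥ 0`; Leibniz, `|v| ≤ log 2 − a` on the support). [folklore] -/
theorem norm_iteratedDeriv_kappaTL_le {n : ℕ} (hn : n ≤ 3) {a : ℝ} (ha : a ≤ 0) {ε : ℝ} (hε : 0 < ε)
    (hε1 : ε ≤ 1) {t : ℝ} (ht : 0 ≤ t) (v : ℝ) :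
    ‖iteratedDeriv n (kappaTL a ε t) v‖ ≤ (Real.log 2 - a + 3) * kappaTD a ε t := by
  have hD := kappaTD_nonneg a hε ht
  have hl2 : 0 < Real.log 2 := Real.log_pos one_lt_two
  by_cases hv : v ∈ tsupport (kappaTL a ε t)
  · have hv' := tsupport_kappaTL_subset hε t hv
    have habs : |v| ≤ Real.log 2 - a := by
      rw [abs_le]; constructor <;> linarith [hv'.1, hv'.2]
    rw [← norm_iteratedFDeriv_eq_norm_iteratedDeriv]
    have hLeib := norm_iteratedFDeriv_mul_le (contDiff_id (𝕜 := ℝ) (E := ℝ)) (contDiff_kappaT a ε t) v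
      (n := n) (N := (n : ℕ∞)) (by exact_mod_cast le_rfl)
    refine hLeib.trans ?_
    have hterm : ∀ i ∈ Finset.range (n + 1), (n.choose i : ℝ) * ‖iteratedFDeriv ℝ i (fun x : ℝ => x) v‖ *
        ‖iteratedFDeriv ℝ (n - i) (kappaT a ε t) v‖ ≤
        (if i = 0 then |v| * kappaTD a ε t else if i = 1 then n * kappaTD a ε t else 0) := by
      intro i hi
      have hin : i ≤ n := Nat.lt_succ_iff.1 (Finset.mem_range.1 hi)
      have hk : ‖iteratedFDeriv ℝ (n - i) (kappaT a ε t) v‖ ≤ kappaTD a ε t := by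
        rw [norm_iteratedFDeriv_eq_norm_iteratedDeriv]
        exact norm_iteratedDeriv_kappaT_le_kappaTD ((Nat.sub_le n i).trans hn) a hε hε1 ht v
      have hid := norm_iteratedFDeriv_id_le i v
      rcases Nat.lt_trichotomy i 1 with h0 | h1 | h2
      · have : i = 0 := by omega
        subst this
        simp only [if_true, Nat.choose_zero_right, Nat.cast_one, one_mul] at hid ⊢
        exact mul_le_mul hid hk (norm_nonneg _) (abs_nonneg _)
      · subst h1
        simp only [one_ne_zero, if_false, if_true, Nat.choose_one_right] at hid ⊢
        calc (n : ℝ) * ‖iteratedFDeriv ℝ 1 (fun x : ℝ => x) v‖ * ‖iteratedFDeriv ℝ (n - 1) (kappaT a ε t) v‖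
            ≤ (n : ℝ) * 1 * kappaTD a ε t := by gcongr
          _ = n * kappaTD a ε t := by ring
      · have hi0 : i ≠ 0 := by omega
        have hi1 : i ≠ 1 := by omega
        simp only [hi0, hi1, if_false] at hid ⊢
        have : ‖iteratedFDeriv ℝ i (fun x : ℝ => x) v‖ = 0 := le_antisymm hid (norm_nonneg _)
        rw [this, mul_zero, zero_mul]
    calc ∑ i ∈ Finset.range (n + 1), (n.choose i : ℝ) * ‖iteratedFDeriv ℝ i (fun x : ℝ => x) v‖ *
          ‖iteratedFDeriv ℝ (n - i) (kappaT a ε t) v‖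
        ≤ ∑ i ∈ Finset.range (n + 1),
            (if i = 0 then |v| * kappaTD a ε t else if i = 1 then n * kappaTD a ε t else 0) :=
          Finset.sum_le_sum hterm
      _ ≤ ∑ i ∈ Finset.range (n + 1),
            ((if i = 0 then |v| * kappaTD a ε t else 0) + (if i = 1 then n * kappaTD a ε t else 0)) := by
          refine Finset.sum_le_sum fun i _ => ?_
          by_cases h0 : i = 0
          · subst h0; simp
          · by_cases h1 : i = 1
            · subst h1; simp
            · simp [h0, h1]
      _ ≤ |v| * kappaTD a ε t + n * kappaTD a ε t := by
          rw [Finset.sum_add_distrib, Finset.sum_ite_eq', Finset.sum_ite_eq']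
          have h0 : (0 : ℕ) ∈ Finset.range (n + 1) := by simp
          rw [if_pos h0]
          split_ifs
          · exact le_rfl
          · have : 0 ≤ (n : ℝ) * kappaTD a ε t := by positivity
            linarith
      _ ≤ (Real.log 2 - a + 3) * kappaTD a ε t := by
          have hn3 : (n : ℝ) ≤ 3 := by exact_mod_cast hn
          nlinarith
  · rw [iteratedDeriv_eq_zero_of_notMem_tsupport hv, norm_zero]
    nlinarith

end Log

/-! ## The two weights for the type I sums -/

section Weights

/-- The cube weight of `SmoothCubeWeights` is `gOf κ_t`. [folklore] -/
theorem gfun_eq_gOf (a ε t : ℝ) : gfun a ε t = gOf (kappaT a ε t) := rfl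

/-- **The `log`-twisted cube weight** `(log r) g_t(r) = gOf (vκ_t) (r)`. [folklore] -/
def gfunL (a ε t : ℝ) : ℝ → ℝ := gOf (kappaTL a ε t)

/-- `gfunL (r) = (log r) g_t(r)` for `r > 0`. [folklore] -/
theorem gfunL_of_pos (a ε t : ℝ) {r : ℝ} (hr : 0 < r) : gfunL a ε t r = Real.log r * gfun a ε t r := by
  rw [gfunL, gOf_of_pos _ hr, kappaTL, gfun_of_pos hr]

/-- `gfunL (r) = (log r) g_t(r)` for all `r` (both sides vanish for `r ≤ 0`). [folklore] -/
theorem gfunL_eq (a ε t r : ℝ) : gfunL a ε t r = Real.log r * gfun a ε t r := by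
  by_cases hr : 0 < r
  · exact gfunL_of_pos a ε t hr
  · rw [gfunL, gOf, if_neg hr, gfun, if_neg hr, mul_zero]

/-- **Properties of the `log`-twisted weight** (`a ≤ 0`, `0 < ε ≤ 1`, `t ≥ 0`), complex-valued,
with `D = (log 2 − a + 3) D_t`: `C³`, compact support in `[e^a/2, 1]`, `|g| ≤ D`, `∫|g| ≤ D`,
`∫|g⁽³⁾| ≤ 48 D e^{-3a}`. [folklore] -/
theorem gfunLC_props {a ε t : ℝ} (ha : a ≤ 0) (hε : 0 < ε) (hε1 : ε ≤ 1) (ht : 0 ≤ t) :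
    ContDiff ℝ 3 (gOfC (kappaTL a ε t)) ∧ HasCompactSupport (gOfC (kappaTL a ε t)) ∧
      Function.support (gOfC (kappaTL a ε t)) ⊆ Icc (Real.exp a / 2) 1 ∧
      (∀ r, ‖gOfC (kappaTL a ε t) r‖ ≤ (Real.log 2 - a + 3) * kappaTD a ε t) ∧
      (∫ r, ‖gOfC (kappaTL a ε t) r‖ ≤ (Real.log 2 - a + 3) * kappaTD a ε t) ∧
      (∫ r, ‖iteratedDeriv 3 (gOfC (kappaTL a ε t)) r‖ ≤
        48 * ((Real.log 2 - a + 3) * kappaTD a ε t) * Real.exp (-3 * a)) :=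
  gOfC_props (contDiff_kappaTL a ε t) (fun _ hv => kappaTL_eq_zero_of_le hv)
    (fun _ hv => kappaTL_eq_zero_of_ge hε hv) ha
    (by have := kappaTD_nonneg a hε ht; have := Real.log_pos one_lt_two; nlinarith)
    fun _ hn v => norm_iteratedDeriv_kappaTL_le hn ha hε hε1 ht v

/-- **Properties of the cube weight via the general profile** (the same conclusions as
`gfunC_props`, with the single constant `D_t`). [folklore] -/
theorem gfunC_props' {a ε t : ℝ} (ha : a ≤ 0) (hε : 0 < ε) (hε1 : ε ≤ 1) (ht : 0 ≤ t) :
    ContDiff ℝ 3 (gOfC (kappaT a ε t)) ∧ HasCompactSupport (gOfC (kappaT a ε t)) ∧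
      Function.support (gOfC (kappaT a ε t)) ⊆ Icc (Real.exp a / 2) 1 ∧
      (∀ r, ‖gOfC (kappaT a ε t) r‖ ≤ kappaTD a ε t) ∧
      (∫ r, ‖gOfC (kappaT a ε t) r‖ ≤ kappaTD a ε t) ∧
      (∫ r, ‖iteratedDeriv 3 (gOfC (kappaT a ε t)) r‖ ≤ 48 * kappaTD a ε t * Real.exp (-3 * a)) :=
  gOfC_props (contDiff_kappaT a ε t) (fun _ hv => kappaT_eq_zero_of_le hv)
    (fun _ hv => kappaT_eq_zero_of_ge hε hv) ha (kappaTD_nonneg a hε ht)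
    fun _ hn v => norm_iteratedDeriv_kappaT_le_kappaTD hn a hε hε1 ht v

end Weights

end Literature.NumberTheory.Sieve.SmoothWeights
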